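import Literature.Algebra.EuclideanLattices.RegevPeriodicGaussianState
import Literature.Computability.QuantumComplexity.QFTZModPow
import HarnessLib

/-!
# Regev 2009, Lemma 3.14: the QFT maps the periodic Gaussian state of `L*/R` to that of `L`

Topic `Algebra/EuclideanLattices` (family `pqc`). Serves the decomposition of the named fact
`Literature.Computability.Cryptography.regev_lwe_to_sivp_quantum` (pqc.S19; Regev, J. ACM 56 (2009),
Thm 1.1): the quantum half of the iterative step, **Lemma 3.14** (author's version arXiv:2401.03703,
p. 20). In the coordinates `s ∈ ℤ_Rⁿ` of `Λ = L*/R` (basis `eᵢ = L*ᵢ/R`) the state before the Fourier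
transform has amplitudes `ϑ₂(s) = ρ(x_s + L*)` (`RegevPeriodicGaussianState`); the printed computation
"`∑_s ∑_r ρ(L*s/R − L*r) e^{2πi⟨s,t⟩/R} = … = det(RL) ∑_{y ∈ RL} ρ(y − Lt)`" says that after the QFT on
`ℤ_Rⁿ` the amplitude of `|t⟩` is proportional to `ρ(Lt + RL)`: **the periodic Gaussian state of the
pair `RL ≤ L` in the coordinates `t` of the basis `Lⱼ = e*ⱼ/R` of `L`** — an object of exactly the
same kind, to which Claim 3.13 applies again ("`RL ∩ P(L)`… this state is exponentially close").

This file PROVES that statement as an identity of vectors in `ℂ^{ℤ_Rⁿ}` (theorems, plus definitions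
with bodies):

* `Regev2009.primalBasis Λ e R` (`Lⱼ = e*ⱼ/R`), `Regev2009.primalLattice Λ e R = L` (its `ℤ`-span,
  a full-rank lattice with `ℤ`-basis `primalZBasis`), `scaledLattice_primalLattice : RL = Λ*`,
  `reprPt_primal_eq_dualPt : x'_t = u_t = ∑ tⱼLⱼ`;
* `Regev2009.tsum_dual_eq_periodicAmp_primal` — `∑_{y ∈ Λ*} ρ(y − u_t) = ϑ₂'(t)`, the amplitude
  `periodicAmp L (Lⱼ) R t = ρ(u_t + RL)`;
* `Regev2009.qft_periodicAmp_vec` — **`F ϑ₂ = c · ϑ₂'`** with the unitary `F = qftMatrix ι R`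
  (`QFTZModPow`) and the constant `c = R^{-n/2} vol(Λ)⁻¹ > 0` (`qftConst`, `qftConst_pos`).

## References

* O. Regev, *On lattices, learning with errors, random linear codes, and cryptography*, J. ACM 56
  (2009), art. 34; author's version arXiv:2401.03703, Lemma 3.14 (proof, p. 20) [Regev2009].
* M. A. Nielsen, I. L. Chuang, *Quantum Computation and Quantum Information*, CUP 2010, §5.1
  [NielsenChuang2010].
-/

noncomputable section

open Module Metric Complex Matrix
open scoped Real InnerProductSpace FourierTransform

namespace Literature.Algebra.EuclideanLattices

namespace Regev2009

open Literature.Computability.QuantumComplexity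

variable {V : Type*} [NormedAddCommGroup V] [InnerProductSpace ℝ V] [FiniteDimensional ℝ V]
variable {ι : Type*} [Fintype ι] [DecidableEq ι]
variable (Λ : Submodule ℤ V) [DiscreteTopology Λ] [IsZLattice ℝ Λ] (e : Basis ι ℤ Λ)

/-! ### The lattice `L` with basis `Lⱼ = e*ⱼ/R` -/

/-- **The basis `Lⱼ = e*ⱼ / R`** of `V` (Regev: the given basis of `L`, when `Λ = L*/R` has basis
`eᵢ = L*ᵢ/R`). [cite: Regev2009, Lemma 3.14] -/
def primalBasis (R : ℕ) [NeZero R] : Basis ι ℝ V :=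
  (LinearMap.BilinForm.dualBasis (innerₗ V : LinearMap.BilinForm ℝ V) innerₗ_nondegenerate
    (e.ofZLatticeBasis ℝ Λ)).unitsSMul fun _ => Units.mk0 ((R : ℝ)⁻¹) (inv_ne_zero (by exact_mod_cast NeZero.ne R))

/-- `Lⱼ = R⁻¹ e*ⱼ`. [folklore] -/
theorem primalBasis_apply (R : ℕ) [NeZero R] (j : ι) : primalBasis Λ e R j = (R : ℝ)⁻¹ • dualVec Λ e j := by
  rw [primalBasis, Basis.unitsSMul_apply]
  rfl

/-- **The lattice `L = span_ℤ {Lⱼ}`** (a full-rank lattice: Mathlib's `ZSpan` instances apply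
through this abbreviation). [cite: Regev2009, Lemma 3.14] -/
abbrev primalLattice (R : ℕ) [NeZero R] : Submodule ℤ V := Submodule.span ℤ (Set.range (primalBasis Λ e R))

/-- **The `ℤ`-basis `(Lⱼ)` of `L`.** [folklore] -/
def primalZBasis (R : ℕ) [NeZero R] : Basis ι ℤ (primalLattice Λ e R) := (primalBasis Λ e R).restrictScalars ℤ

/-- Values of the `ℤ`-basis. [folklore] -/
theorem coe_primalZBasis (R : ℕ) [NeZero R] (j : ι) :
    ((primalZBasis Λ e R j : primalLattice Λ e R) : V) = (R : ℝ)⁻¹ • dualVec Λ e j :=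
  (Basis.restrictScalars_apply ℤ (primalBasis Λ e R) j).trans (primalBasis_apply Λ e R j)

/-- **`RL = Λ*`**: `R` times the lattice spanned by `e*ⱼ/R` is the `ℤ`-span of the dual basis `e*`,
which is the dual lattice (`dualLattice_eq_span_dualBasis`). [cite: Regev2009, Lemma 3.14 ("(L*/R)* = RL")] -/
theorem scaledLattice_primalLattice (R : ℕ) [NeZero R] :
    scaledLattice (primalLattice Λ e R) R = dualLattice Λ := by
  have hR : (R : ℝ) ≠ 0 := by exact_mod_cast NeZero.ne R
  rw [dualLattice_eq_span_dualBasis Λ e, scaledLattice, primalLattice, Submodule.map_span, ← Set.range_comp]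
  congr 1
  ext v
  simp only [Set.mem_range, Function.comp_apply, LinearMap.smul_apply, LinearMap.id_coe, id_eq, primalBasis_apply]
  constructor
  · rintro ⟨j, rfl⟩
    refine ⟨j, ?_⟩
    rw [natCast_zsmul, ← Nat.cast_smul_eq_nsmul ℝ, smul_smul, mul_inv_cancel₀ hR, one_smul]
    rfl
  · rintro ⟨j, rfl⟩
    refine ⟨j, ?_⟩
    rw [natCast_zsmul, ← Nat.cast_smul_eq_nsmul ℝ, smul_smul, mul_inv_cancel₀ hR, one_smul]
    rfl

/-- **`x'_t = u_t`**: the representative with coordinates `t` in the basis `(Lⱼ)` is the dual point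
`u_t = ∑ⱼ (tⱼ/R) e*ⱼ` of `RegevQFTPeriodicGaussian`. [cite: Regev2009, Lemma 3.14 ("L t")] -/
theorem reprPt_primal_eq_dualPt (R : ℕ) [NeZero R] (t : ι → ZMod R) :
    reprPt (primalLattice Λ e R) (primalZBasis Λ e R) R t = dualPt Λ e R t := by
  rw [reprPt, latticePt_eq_sum, dualPt]
  refine Finset.sum_congr rfl fun j _ => ?_
  rw [coe_primalZBasis, smul_smul, Int.cast_natCast, div_eq_mul_inv]

/-- **`∑_{y ∈ Λ*} ρ(y − u_t) = ϑ₂'(t) = ρ(u_t + RL)`**, the amplitude `periodicAmp L (Lⱼ) R t` of the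
periodic Gaussian state of the pair `RL ≤ L`. [cite: Regev2009, Lemma 3.14 (proof, p. 20)] -/
theorem tsum_dual_eq_periodicAmp_primal (R : ℕ) [NeZero R] (t : ι → ZMod R) :
    ∑' y : dualLattice Λ, gaussianFunction 1 ((y : V) - dualPt Λ e R t) =
      periodicAmp (primalLattice Λ e R) (primalZBasis Λ e R) R t := by
  rw [periodicAmp_eq_toReal_gaussianMass, reprPt_primal_eq_dualPt, scaledLattice_primalLattice,
    gaussianMass_neg_center, gaussianMass_coe_eq_ofReal_tsum (dualLattice Λ) one_ne_zero,
    ENNReal.toReal_ofReal (tsum_nonneg fun _ => (gaussianFunction_pos _ _).le)]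

/-! ### The QFT step -/

/-- **The constant `c = R^{-n/2} · vol(Λ)⁻¹`** (`= R^{-n/2} det(RL)`). [cite: Regev2009, Lemma 3.14 (proof)] -/
def qftConst [MeasurableSpace V] [BorelSpace V] (R : ℕ) : ℝ :=
  (Real.sqrt ((R : ℝ) ^ Fintype.card ι))⁻¹ * (ZLattice.covolume Λ)⁻¹

omit [DecidableEq ι] in
/-- `c > 0`. [folklore] -/
theorem qftConst_pos [MeasurableSpace V] [BorelSpace V] (R : ℕ) [NeZero R] : 0 < qftConst (ι := ι) Λ R := by
  unfold qftConst
  refine mul_pos (inv_pos.2 (Real.sqrt_pos.2 (pow_pos ?_ _))) (inv_pos.2 (ZLattice.covolume_pos Λ MeasureTheory.volume))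
  exact_mod_cast Nat.pos_of_ne_zero (NeZero.ne R)

omit [DecidableEq ι] in
/-- The character of the Fourier identity is the QFT kernel. [folklore] -/
theorem fourierChar_coe_eq_qftKernel (R : ℕ) [NeZero R] (s t : ι → ZMod R) :
    ((𝐞 ((∑ i, (((s i).val : ℤ) : ℝ) * (t i).val) / R) : Circle) : ℂ) = QFTZMod.qftKernel R s t := by
  rw [QFTZMod.qftKernel_eq_exp, Real.fourierChar_apply]
  congr 1
  push_cast
  ring

/-- **Regev 2009, Lemma 3.14 — the QFT step as a vector identity: `F ϑ₂ = c · ϑ₂'`.** Applying the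
unitary quantum Fourier transform on `ℤ_Rⁿ` to the periodic Gaussian state of `RΛ ≤ Λ`
(`ϑ₂(s) = ρ(x_s + RΛ)`, `Λ = L*/R`) gives `c` times the periodic Gaussian state of `RL ≤ L`
(`ϑ₂'(t) = ρ(u_t + RL)`, `u_t = ∑ tⱼLⱼ`), `c = R^{-n/2} vol(Λ)⁻¹ > 0`.
[cite: Regev2009, Lemma 3.14 (proof, p. 20: "the resulting state can be equivalently written as …")] -/
theorem qft_periodicAmp_vec [MeasurableSpace V] [BorelSpace V] (R : ℕ) [NeZero R] :
    QFTZMod.qftMatrix ι R *ᵥ (fun s => ((periodicAmp Λ e R s : ℝ) : ℂ)) =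
      fun t => ((qftConst (ι := ι) Λ R : ℝ) : ℂ) *
        ((periodicAmp (primalLattice Λ e R) (primalZBasis Λ e R) R t : ℝ) : ℂ) := by
  funext t
  rw [QFTZMod.qftMatrix_mulVec]
  have hsum : ∑ s : ι → ZMod R, ((periodicAmp Λ e R s : ℝ) : ℂ) * QFTZMod.qftKernel R s t =
      ∑ s : ι → ZMod R, ((periodicAmp Λ e R s : ℝ) : ℂ) *
        ((𝐞 ((∑ i, (((s i).val : ℤ) : ℝ) * (t i).val) / R) : Circle) : ℂ) :=
    Finset.sum_congr rfl fun s _ => by rw [fourierChar_coe_eq_qftKernel]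
  rw [hsum, qft_periodicAmp_eq Λ e R t, ← Complex.ofReal_tsum, tsum_dual_eq_periodicAmp_primal, qftConst]
  push_cast
  ring

end Regev2009

end Literature.Algebra.EuclideanLattices

end
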